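import Summits.BirchSwinnertonDyer.Rank1Residual.X12.O11.RamifiedStrictDescent
import Summits.BirchSwinnertonDyer.Rank1Residual.X12.CMSevenAwayFromSeven
import HarnessLib

/-!
# 𝒞₇ headline consumer: FULL BSD on 𝒞₇ ⟸ the three O11 typed inputs (R-tors) ∧ (R-ctrl) ∧ (R-EU)
# at the single prime `7` (cell `bsd-cm`, seat `bsd-cm-ram`; PROVED, conditional on the inputs)

HONEST FRAMING (cell `bsd-cm`, run/shared/lean/pub/bsd-cm/, verbatim in every file of the cell): the
programme isolates, for CM elliptic curves over `ℚ` of analytic rank `≤ 1`, classes on which the FULL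
BSD formula is reduced — strictly by PUBLISHED theorems entering as named-fact binders — to ONE local
problem at ONE prime, and then TYPES that residual problem for construction seats. THIS FILE composes
the planner's REMARK-level assembly `X12.ClassCSeven.forall_bsdp_iff_bsdp_seven` (full BSD on 𝒞₇ ⟺
`BSDp W 7`; inputs BF24, modularity, LLT 2024, Kobayashi 2013, LTYZ 2025 — all published named facts)
with the O11 consumer `X12.O11.bsdp_of_halves` (`BSDp W 7` ⟸ (R-tors) ∧ (R-ctrl) ∧ (R-EU) at `7`,
file `X12/O11/RamifiedStrictDescent.lean`, memo `HOME/bsd-cm-ram/O11-RAMIFIED-DESCENT.md`). Theorems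
only; nothing asserted; 𝒞₇ stays OPEN at `7` because (R-EU) — the ramified Perrin-Riou / BDP-type
elliptic-unit index formula — is NOT in print (BKNO arXiv:2608.06879 §1.4: "report elsewhere").
References: [Miller2011LMS] Def. 1.1; [Cassels1965ArithmeticVIII]; [BurungaleKobayashiNakamuraOta2026].
-/

noncomputable section

open scoped Classical

open WeierstrassCurve NumberField IsDedekindDomain Field
  Literature.NumberTheory.EllipticCurves
  Literature.NumberTheory.EllipticCurves.Rank1Residual
  Literature.NumberTheory.GaloisRepresentations
  Summit.BirchSwinnertonDyer.Rank1Residual.X12.O11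

namespace Summit.BirchSwinnertonDyer.Rank1Residual.X12.ClassCSeven

variable [Fact (Nat.Prime 7)] {W : WeierstrassCurve ℚ} [W.IsElliptic] [W.IsGloballyMinimal]
variable {K : Type} [Field K] [NumberField K] {𝔭 : HeightOneSpectrum (𝓞 K)}
  {W' : WeierstrassCurve ℚ} [W'.IsElliptic] [W'.IsGloballyMinimal] {C : VariableChange ℚ}
  {κ : ZpExtension K 7} {P : W.toAffine.Point} {n : ℕ} {P' : W'.toAffine.Point} {n' : ℕ}

/-- **FULL BSD ON 𝒞₇ ⟸ (R-tors) ∧ (R-ctrl) ∧ (R-EU) at `p = 7`.** For `W ∈ 𝒞₇` (`ClassCSeven W`)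
framed at `7` (`O11.IsFrame W 7 K 𝔭 W' C`: `K = ℚ(√−7)` as a number field with `discr K = −7`,
`𝔭 ∋ 7`, `W'` a globally minimal model of `W^{(−7)}`, `ℚ`-isogenous to `W` — binder `hiso`, the
`7`-isogeny `[√−7]`), generators `P`, `P'` modulo torsion with their `7`-divisibility levels: `BSD(W, p)`
at EVERY prime `p` (the ambient `[Fact (Nat.Prime 7)]` is any instance; `⟨by norm_num⟩` works). CONDITIONAL on (R-tors), (R-ctrl) [derived in the memo], (R-EU) [OPEN]; nothing
booked. [cite: Miller2011LMS, §1 and Def. 1.1] [cite: Cassels1965ArithmeticVIII] -/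
theorem forall_bsdp_of_O11_halves (hCM : bsdTriple_of_hasCM_of_L_one_ne_zero)
    (hmod : hasEntireLFunction_rat) (hLLT : LiLiuTian2024.thm11_bsdp_of_cm_rank_one)
    (hKob : Kobayashi2013.cor14_bsdp_of_cm_rank_one)
    (hLTYZ : LiTianYanZhu2025.thm11_bsdp_of_cm_rank_one) (hGZ : GrossZagier1986_thm_I_7_3)
    (hGZK : rank_eq_analyticRank_of_analyticRank_le_one) (hCassels : bsdRHS_eq_of_isIsogenous)
    (hW : ClassCSeven W)
    (h1 : RamifiedCMStrictTorsionAt W 7) (h2 : RamifiedCMStrictControlAt W 7)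
    (h3 : RamifiedCMEllipticUnitIndexAt W 7)
    (hF : IsFrame W 7 K 𝔭 W' C) (hiso : IsIsogenous W W')
    (hκ : κ.IsAnticyclotomic) (γ : absoluteGaloisGroup K) [Fact (κ.IsTopGenerator γ)]
    (hP : ¬ IsOfFinAddOrder P)
    (hgen : ∀ R : W.toAffine.Point, ∃ (k : ℤ) (T : W.toAffine.Point),
      IsOfFinAddOrder T ∧ R = k • P + T)
    (htors : ∀ Q : (W.baseChange ℚ_[7]).toAffine.Point, 7 • Q = 0 → Q = 0)
    (hdiv : ∃ Q : (W.baseChange ℚ_[7]).toAffine.Point, 7 ^ n • Q = W.toPadicPoint 7 P)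
    (hndiv : ∀ Q : (W.baseChange ℚ_[7]).toAffine.Point, 7 ^ (n + 1) • Q ≠ W.toPadicPoint 7 P)
    (hP' : ¬ IsOfFinAddOrder P')
    (hgen' : ∀ R : W'.toAffine.Point, ∃ (k : ℤ) (T : W'.toAffine.Point),
      IsOfFinAddOrder T ∧ R = k • P' + T)
    (htors' : ∀ Q : (W'.baseChange ℚ_[7]).toAffine.Point, 7 • Q = 0 → Q = 0)
    (hdiv' : ∃ Q : (W'.baseChange ℚ_[7]).toAffine.Point, 7 ^ n' • Q = W'.toPadicPoint 7 P')
    (hndiv' : ∀ Q : (W'.baseChange ℚ_[7]).toAffine.Point, 7 ^ (n' + 1) • Q ≠ W'.toPadicPoint 7 P')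
    (q : ℕ) (hq : q.Prime) : BSDp W q :=
  (forall_bsdp_iff_bsdp_seven hCM hmod hLLT hKob hLTYZ hW).2
    (bsdp_of_halves hmod hGZ hGZK hCassels h1 h2 h3 hF hiso hW.2.2.1 hκ γ hP hgen htors hdiv hndiv
      hP' hgen' htors' hdiv' hndiv') q hq

end Summit.BirchSwinnertonDyer.Rank1Residual.X12.ClassCSeven

end
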